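import Literature.MathematicalPhysics.QuantumFieldTheory.Balaban1983to89.B9Thm37GlueQ
import Literature.MathematicalPhysics.QuantumFieldTheory.Balaban1983to89.B9Thm37GlueTorusCovTowerPU

/-!
# `Balaban1983to89.B9Thm37GlueLevelSumComm` — the averaging line of (3.88) FOR THE MULTI-LEVEL Q′\*aQ′ = Σ_{l≤k} a_l G_lᵀG_l:
# the commutator [M_{h_□}, Σ_l a_l G_lᵀG_l] has a block-DIAGONAL majorant whose size is the SUM OVER THE LEVELS of
# (within-level-block oscillation of h_□) × |a_l|·(weight)²·(#block)·(#components)², and the five Q-binders of the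
# `B9Thm37Glue` lineage (`hQ hKQ hlocQ hrowQ hcolQ` of `B9Thm37GlueSz.thm37_entry*_of_342_lattice_of_387_sz`,
# `B9Thm37GluePU.thm37_entry4_torus`) DISCHARGED for it; instantiated on the k-fold comb TOWER of `B9Thm37GlueTorusCovTower`
# (cell `pub-ymgap`, Track A node N06 [B9] second -b seat dag-n19-b; dag-lead REBALANCE-12; count-neutral MODEL bookkeeping)

References (bib keys): [B9] = `Balaban1985BackgroundPropagators` — T. Bałaban, *Propagators for lattice gauge theories in a
background field*, Commun. Math. Phys. 99 (1985) 389–434; [4] = `Balaban1984PropagatorsII` — T. Bałaban, *Propagators and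
renormalization transformations for lattice gauge theories. II*, Commun. Math. Phys. 96 (1984) 223–250.

THE PRINTED LOCI (only NAMED; certified in the headers of `B9Thm37GlueQ`, `B9Thm37GlueSz`, `B9Thm37GlueTorusCovLevels`):
[B9] (3.88) p. 409, second display line — the averaging term of K(h_□) = [Δ′_a, M_{h_□}]-remainder,
«a_j(L^jη)^{−2}Σ_{x′∈B^j(y^j(x))}L^{−jd}(∂h)(Γ^{(j)}_{x,y^j(x),x′})λ(x′)» ([4] (2.40) third term) — and (3.89) p. 409, its size
«O(M^{−1})»; (3.16) p. 393 — the multi-level quadratic form ⟨A, Q\*aQA⟩ = Σ_{j=0}^{k} a Σ_{b∈Λ_j}(L^jη)^{d−2}|(Q_j(U)A)(b)|²,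
modelled by `B9Thm37GlueTorusCovLevels.levelSum`.  NOTHING printed is asserted: every declaration is a kernel-checked
statement about the component MODEL of the lineage.

THE POINT.  The one-scale leaves of the lineage (`B9Thm37GlueQ.commData_of_conj_osc`, `B9Thm37GlueSz`, `B9Thm37GluePU`) take the
averaging part Q′\*aQ′ of Δ′_a as ONE abstract operator with a block majorant and ONE oscillation bound of h_□ per geometry block;
the multi-level tower of `B9Thm37GlueTorusCovTower` ∕ `…TowerPU` has the (3.87)–(3.88) ALGEBRA for Δ′ = Δ_U + Σ_{l≤k} a_lG_lᵀG_l
(`eq388_tower_torus`, `fixedPoint_tower_torus`) but records as HONEST SCOPE (i) that «NO SMALLNESS of R′ = Σ_□K(h_□)G′_□h_□ is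
claimed».  The located missing coefficient is the size of the AVERAGING LINE of K(h_□) for the LEVEL SUM: here it is computed.
 * §1 `ent_gMeanSq` ∕ `abs_ent_gMeanSq_le`: the matrix of one level G_lᵀG_l (G_l = `gMean blk_l W_l T_l`) couples only sites of
   the SAME level-l block, with entries ≤ wb_l²·#Cp (|W_l| ≤ wb_l, transport entries ≤ 1); `ent_levelSum`: the level sum's matrix.
 * §2 **`hasMajorant_comm_levelSum`**: for a geometry blocking `blk` COARSER than every level (`hnest`) and per-level within-block
   oscillation bounds `o_l(b)` of h on the geometry block b, [M_h, Σ_l a_lG_lᵀG_l] has the block-diagonal majorant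
   `K(b, y′) = 1_{b=y′}·Σ_l |a_l|·o_l(b)·wb_l²·(#Cp)²·n_l` (n_l ≥ #level-l block).
 * §3 **`commData_levelSum`**: the FIVE Q-binders of the lineage for the level sum — majorant, nonnegativity, localisation
   (diagonal ⇒ within any ρ ≥ d(b,b)), located row sums Σ_{y″}K(b,y″)(L^{j″}η)² ≤ 1_{S′_□}(b)·Σ_l ω_l k_l and the same column sums —
   from `o_{l,□}(b) ≤ ω_l·1_{S′_□}(b)` and `|a_l| wb_l²(#Cp)²n_l·(L^{j_b}η)² ≤ k_l`.  Print's sizes (ω_l = O(M^{−1}): h_□ of [4] Sect. A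
   varies on the cube scale while G_l averages over one block; k_l = O(a_l)) are NOT asserted — §4 derives ω_l for the tower.
 * §4 THE k-FOLD COMB TOWER (`towerBlk`, `towerTr` of `B9Thm37GlueTorusCovTower`): nesting from `towerBlk_eq_of_le`, transport
   entries ≤ 1 from `towerTr_orth`, block counts `towerN` from `card_towerBlk_fibre_le` ⇒ **`commData_towerLevelSum`**: the five
   Q-binders for [M_h, Σ_{l≤k} a_lG_lᵀG_l] of the tower operator Δ′ (`towerOp_def`) with
   κ_Q = Σ_{l≤k} ω_l·k_l, for ANY geometry blocking through which the top tower level factors.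

HONEST SCOPE.  (i) Component MODEL of the lineage (`St × Cp → ℝ`, abstract combs and transports); the oscillation bounds `o_l`,
`ω_l` and the size letters `k_l` are HYPOTHESES here (print: O(M^{−1}), O(a_l)); for the torus partition of unity `hSU` of [3] (1.118)
the per-bond bound 4d∕M₀ (`B9Thm37GluePU.hθ_torus`) telescoped along the comb paths inside a level-l tower block gives
ω_l ≤ min(1, 2·(Σ_{j<l} depth_j)·4d∕M₀) — NOT typed here (GlueQ §10 `osc_of_linked` is the device).  (ii) Nothing of (3.89)'s
D-part (the ∂h_□∕Δh_□ coefficients: `B9Thm37GlueSz`∕`…PU`), of Corollary 3.6, of the convergence of Σ R′ⁿ or of Theorems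
3.1–3.3∕3.7 is touched.  Value = MODEL kernel bookkeeping (the multi-level averaging line's coefficient), NOT summit progress;
NOT continuum, NOT Clay, NOT a claim about print.
-/

namespace Literature.MathematicalPhysics.QuantumFieldTheory.Balaban1983to89.B9Thm37GlueLevelSumComm

open Literature.MathematicalPhysics.QuantumFieldTheory.Balaban1983to89
open Finset B6RandomWalk B9Thm37Sum B9Thm34Ext B9Thm37GlueQ B9Thm37GlueTorusCov B9Thm37GlueTorusCovComp
  B9Thm37GlueTorusCovLevels B9Thm37GlueTorusCovTower B9Thm37GlueTorusCovTowerPU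

noncomputable section

/-! ## §1  Matrix entries of one level G_lᵀG_l and of the level sum -/

section Entries

variable {St B Cp : Type} [Fintype St] [DecidableEq St] [DecidableEq B] [Fintype Cp] [DecidableEq Cp]

/-- The block mean of a delta field: `(G δ_q)(β, i) = 1_{blk q₁ = β}·W(q₁)·T(q₁) i q₂`. [folklore] -/
private theorem gMean_delta (blkB : St → B) (W : St → ℝ) (T : St → Cp → Cp → ℝ) (q : St × Cp) (β : B) (i : Cp) :
    gMean blkB W T (fun r => if q = r then (1 : ℝ) else 0) (β, i) =
      if blkB q.1 = β then W q.1 * T q.1 i q.2 else 0 := by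
  rw [gMean_apply]
  have hx : ∀ x, x ≠ q.1 → (∑ j, T x i j * (if q = (x, j) then (1 : ℝ) else 0)) = 0 := fun x hx =>
    Finset.sum_eq_zero fun j _ => by
      rw [if_neg (fun h => hx (by rw [h])), mul_zero]
  rw [Finset.sum_eq_single q.1 (fun x _ hxq => by rw [hx x hxq, mul_zero, ite_self]) (fun h => absurd (mem_univ _) h)]
  have hq : (∑ j, T q.1 i j * (if q = (q.1, j) then (1 : ℝ) else 0)) = T q.1 i q.2 := by
    rw [Finset.sum_eq_single q.2 (fun j _ hj => by
      rw [if_neg (fun h => hj (by rw [Prod.ext_iff] at h; exact h.2.symm)), mul_zero]) (fun h => absurd (mem_univ _) h)]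
    rw [if_pos (Prod.ext rfl rfl), mul_one]
  rw [hq]

/-- **MATRIX OF ONE LEVEL G_lᵀG_l** (`G = gMean blk W T`, `Gᵀ = gMeanT blk W T`): it couples only sites of the SAME block,
`(GᵀG)((x,i′),(x′,j′)) = 1_{blk x′ = blk x}·W(x)W(x′)·Σ_i T(x) i i′·T(x′) i j′`.
[cite: Balaban1985BackgroundPropagators, (3.16) p.393] -/
theorem ent_gMeanSq (blkB : St → B) (W : St → ℝ) (T : St → Cp → Cp → ℝ) (p q : St × Cp) :
    ent (gMeanT blkB W T ∘ₗ gMean blkB W T) p q =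
      if blkB q.1 = blkB p.1 then W p.1 * W q.1 * ∑ i, T p.1 i p.2 * T q.1 i q.2 else 0 := by
  unfold ent
  rw [LinearMap.comp_apply, gMeanT_apply]
  simp_rw [gMean_delta]
  by_cases hb : blkB q.1 = blkB p.1
  · rw [if_pos hb]
    simp_rw [if_pos hb]
    rw [Finset.mul_sum, Finset.mul_sum]
    exact Finset.sum_congr rfl fun i _ => by ring
  · rw [if_neg hb]
    simp_rw [if_neg hb]
    simp

/-- **SIZE OF THE ENTRIES**: with `|W| ≤ wb` and transport entries `≤ 1`, `|(GᵀG)(p, q)| ≤ 1_{same block}·wb²·#Cp` (the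
model of the block average Q_j(U) of (3.19): L^{−jd}-weights times transports R(U(Γ))). [cite: Balaban1985BackgroundPropagators, (3.16) + (3.19) p.393] -/
theorem abs_ent_gMeanSq_le (blkB : St → B) {W : St → ℝ} {T : St → Cp → Cp → ℝ} {wb : ℝ} (hW : ∀ x, |W x| ≤ wb)
    (hT : ∀ x i i', |T x i i'| ≤ 1) (p q : St × Cp) :
    |ent (gMeanT blkB W T ∘ₗ gMean blkB W T) p q| ≤
      if blkB q.1 = blkB p.1 then wb ^ 2 * (Fintype.card Cp : ℝ) else 0 := by
  rw [ent_gMeanSq]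
  have hwb : 0 ≤ wb := (abs_nonneg _).trans (hW p.1)
  split_ifs with hb
  · rw [abs_mul, abs_mul]
    have h1 : |∑ i, T p.1 i p.2 * T q.1 i q.2| ≤ (Fintype.card Cp : ℝ) := by
      calc |∑ i, T p.1 i p.2 * T q.1 i q.2| ≤ ∑ i, |T p.1 i p.2 * T q.1 i q.2| := Finset.abs_sum_le_sum_abs _ _
        _ ≤ ∑ _i : Cp, (1 : ℝ) := Finset.sum_le_sum fun i _ => by
            rw [abs_mul]
            calc |T p.1 i p.2| * |T q.1 i q.2| ≤ 1 * 1 :=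
                  mul_le_mul (hT _ _ _) (hT _ _ _) (abs_nonneg _) zero_le_one
              _ = 1 := one_mul _
        _ = (Fintype.card Cp : ℝ) := by simp
    calc |W p.1| * |W q.1| * |∑ i, T p.1 i p.2 * T q.1 i q.2| ≤ wb * wb * (Fintype.card Cp : ℝ) :=
          mul_le_mul (mul_le_mul (hW _) (hW _) (abs_nonneg _) hwb) h1 (abs_nonneg _) (mul_nonneg hwb hwb)
      _ = wb ^ 2 * (Fintype.card Cp : ℝ) := by ring
  · simp

variable {J : Type} [Fintype J]

/-- **MATRIX OF THE LEVEL SUM**: `(Σ_l a_lG_lᵀG_l)(p, q) = Σ_l a_l·(G_lᵀG_l)(p, q)`. [cite: Balaban1985BackgroundPropagators, (3.16) p.393] -/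
theorem ent_levelSum (blkJ : J → St → B) (W : J → St → ℝ) (T : J → St → Cp → Cp → ℝ) (a : J → ℝ) (p q : St × Cp) :
    ent (levelSum blkJ W T a) p q = ∑ j, a j * ent (gMeanT (blkJ j) (W j) (T j) ∘ₗ gMean (blkJ j) (W j) (T j)) p q := by
  unfold ent
  rw [levelSum_apply]
  rfl

end Entries

/-! ## §2  The block-diagonal majorant of [M_h, Σ_l a_lG_lᵀG_l] -/

section Majorant

variable {g : B9.Geometry} [Fintype g.Site] [DecidableEq g.Site] {R : ℝ} {H : Prop}
  {St B Cp J : Type} [Fintype St] [DecidableEq St] [DecidableEq B] [Fintype Cp] [DecidableEq Cp] [Fintype J]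

omit [Fintype g.Site] [DecidableEq g.Site] [DecidableEq St] [DecidableEq Cp] [Fintype J] in
/-- Counting: the sites of the level-`j` block of `x`, with all components, number at most `n·#Cp`. [folklore] -/
private theorem card_levelBlock_prod_le (blkB : St → B) {n : ℕ} (x : St)
    (hn : (univ.filter fun x' => blkB x' = blkB x).card ≤ n) :
    ((univ.filter fun q : St × Cp => blkB q.1 = blkB x).card : ℝ) ≤ (n : ℝ) * (Fintype.card Cp : ℝ) := by
  have h : (univ.filter fun q : St × Cp => blkB q.1 = blkB x) = (univ.filter fun x' => blkB x' = blkB x) ×ˢ univ := by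
    ext q
    simp
  rw [h, Finset.card_product, Finset.card_univ]
  push_cast
  exact mul_le_mul_of_nonneg_right (by exact_mod_cast hn) (Nat.cast_nonneg _)

/-- **THE AVERAGING LINE OF (3.88) FOR THE MULTI-LEVEL Q′\*aQ′, AS A BLOCK MAJORANT.**  Let the geometry blocking `blk` be
coarser than every level blocking (`hnest`: same level-`j` block ⇒ same geometry block), `|W_j| ≤ wb_j`, transport entries `≤ 1`,
level-`j` blocks of `≤ n_j` sites, and let `h` oscillate by at most `o_j(b) ≥ 0` across any two sites of a common level-`j` block
inside the geometry block `b`.  Then `[M_h, Σ_j a_jG_jᵀG_j]` has the block-DIAGONAL majorant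
`K(b, y′) = 1_{b = y′}·Σ_j |a_j|·o_j(b)·(wb_j²·(#Cp)²·n_j)`.
[cite: Balaban1985BackgroundPropagators, (3.88) p.409 (second display line); Balaban1984PropagatorsII, (2.40) p.230 (third term)] -/
theorem hasMajorant_comm_levelSum (blk : St × Cp → g.Site) (blkJ : J → St → B) (W : J → St → ℝ)
    (T : J → St → Cp → Cp → ℝ) (a : J → ℝ) (wb : J → ℝ) (n : J → ℕ)
    (hnest : ∀ j (p q : St × Cp), blkJ j q.1 = blkJ j p.1 → blk q = blk p)
    (hW : ∀ j x, |W j x| ≤ wb j) (hT : ∀ j x i i', |T j x i i'| ≤ 1)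
    (hn : ∀ j x, (univ.filter fun x' => blkJ j x' = blkJ j x).card ≤ n j)
    (hs : St → ℝ) (o : J → g.Site → ℝ) (ho0 : ∀ j b, 0 ≤ o j b)
    (hosc : ∀ j (p q : St × Cp), blkJ j q.1 = blkJ j p.1 → |hs p.1 - hs q.1| ≤ o j (blk p)) :
    HasMajorant (g := toB6 g R H) blk
      (mulOp (hs ∘ Prod.fst) * levelSum blkJ W T a - levelSum blkJ W T a * mulOp (hs ∘ Prod.fst))
      (fun b y' : g.Site => if b = y' then ∑ j, |a j| * o j b * (wb j ^ 2 * (Fintype.card Cp : ℝ) ^ 2 * n j) else 0) := by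
  haveI : DecidableEq (toB6 g R H).Site := inferInstanceAs (DecidableEq g.Site)
  refine hasMajorant_of_rowBlockSum_le (G := toB6 g R H) blk fun p y' => ?_
  -- entrywise bound: |(h p₁ − h q₁)·(LS)(p,q)| ≤ Σ_j |a_j|·o_j(blk p)·wb_j²·#Cp·1_{same j-block}
  have hent : ∀ q : St × Cp,
      |ent (mulOp (hs ∘ Prod.fst) * levelSum blkJ W T a - levelSum blkJ W T a * mulOp (hs ∘ Prod.fst)) p q| ≤
        ∑ j, |a j| * o j (blk p) * (wb j ^ 2 * (Fintype.card Cp : ℝ)) *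
          (if blkJ j q.1 = blkJ j p.1 then (1 : ℝ) else 0) := fun q => by
    rw [ent_comm_mulOp, ent_levelSum, Function.comp_apply, Function.comp_apply, Finset.mul_sum, ]
    refine (Finset.abs_sum_le_sum_abs _ _).trans (Finset.sum_le_sum fun j _ => ?_)
    by_cases hb : blkJ j q.1 = blkJ j p.1
    · rw [if_pos hb, mul_one]
      have h1 := abs_ent_gMeanSq_le (blkJ j) (hW j) (hT j) p q
      rw [if_pos hb] at h1
      have h2 := hosc j p q hb
      calc |(hs p.1 - hs q.1) * (a j * ent (gMeanT (blkJ j) (W j) (T j) ∘ₗ gMean (blkJ j) (W j) (T j)) p q)|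
          = |a j| * (|hs p.1 - hs q.1| * |ent (gMeanT (blkJ j) (W j) (T j) ∘ₗ gMean (blkJ j) (W j) (T j)) p q|) := by
            rw [abs_mul, abs_mul]; ring
        _ ≤ |a j| * (o j (blk p) * (wb j ^ 2 * (Fintype.card Cp : ℝ))) :=
            mul_le_mul_of_nonneg_left (mul_le_mul h2 h1 (abs_nonneg _) (ho0 _ _)) (abs_nonneg _)
        _ = |a j| * o j (blk p) * (wb j ^ 2 * (Fintype.card Cp : ℝ)) := by ring
    · rw [if_neg hb, mul_zero]
      have h0 : ent (gMeanT (blkJ j) (W j) (T j) ∘ₗ gMean (blkJ j) (W j) (T j)) p q = 0 := by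
        rw [ent_gMeanSq, if_neg hb]
      rw [h0, mul_zero, mul_zero, abs_zero]
  -- sum the entrywise bound over the block y′
  have hF0 : ∀ j, 0 ≤ |a j| * o j (blk p) * (wb j ^ 2 * (Fintype.card Cp : ℝ)) := fun j =>
    mul_nonneg (mul_nonneg (abs_nonneg _) (ho0 _ _)) (mul_nonneg (sq_nonneg _) (Nat.cast_nonneg _))
  by_cases hpy : blk p = y'
  · rw [if_pos hpy]
    refine (Finset.sum_le_sum fun q _ => hent q).trans ?_
    refine (Finset.sum_le_sum_of_subset_of_nonneg (Finset.filter_subset _ _) fun q _ _ =>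
      Finset.sum_nonneg fun j _ => mul_nonneg (hF0 j) (by split_ifs <;> norm_num)).trans ?_
    rw [Finset.sum_comm]
    refine Finset.sum_le_sum fun j _ => ?_
    rw [← Finset.mul_sum]
    have hcnt : ∑ q : St × Cp, (if blkJ j q.1 = blkJ j p.1 then (1 : ℝ) else 0) ≤ (n j : ℝ) * (Fintype.card Cp : ℝ) := by
      rw [← Finset.sum_filter, Finset.sum_const, nsmul_eq_mul, mul_one]
      exact card_levelBlock_prod_le (blkJ j) p.1 (hn j p.1)
    calc |a j| * o j (blk p) * (wb j ^ 2 * (Fintype.card Cp : ℝ)) *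
          ∑ q : St × Cp, (if blkJ j q.1 = blkJ j p.1 then (1 : ℝ) else 0)
        ≤ |a j| * o j (blk p) * (wb j ^ 2 * (Fintype.card Cp : ℝ)) * ((n j : ℝ) * (Fintype.card Cp : ℝ)) :=
          mul_le_mul_of_nonneg_left hcnt (hF0 j)
      _ = |a j| * o j (blk p) * (wb j ^ 2 * (Fintype.card Cp : ℝ) ^ 2 * n j) := by ring
  · rw [if_neg hpy]
    refine (Finset.sum_eq_zero fun q hq => ?_).le
    simp only [Finset.mem_filter, Finset.mem_univ, true_and] at hq
    rw [abs_eq_zero, ent_comm_mulOp, ent_levelSum]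
    refine mul_eq_zero_of_right _ (Finset.sum_eq_zero fun j _ => ?_)
    by_cases hb : blkJ j q.1 = blkJ j p.1
    · exact absurd ((hnest j p q hb).symm.trans hq) hpy
    · rw [ent_gMeanSq, if_neg hb, mul_zero]

end Majorant

/-! ## §3  The five Q-binders of the lineage for the level sum -/

section Bundled

variable {g : B9.Geometry} [Fintype g.Site] [DecidableEq g.Site] {R : ℝ} {H : Prop}
  {St B Cp J ι : Type} [Fintype St] [DecidableEq St] [DecidableEq B] [Fintype Cp] [DecidableEq Cp] [Fintype J]

/-- **THE Q-DATA OF THE LINEAGE FOR Q := Σ_l a_lG_lᵀG_l** (`hQ`, `hKQ`, `hlocQ`, `hrowQ`, `hcolQ` of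
`B9Thm37GlueSz.thm37_entry*_of_342_lattice_of_387_sz` ∕ `B9Thm37GluePU.thm37_entry4_torus`, with the block-DIAGONAL kernel
`K_{Q,□}(b, y′) = 1_{b=y′}·Σ_l |a_l|·o_{l,□}(b)·wb_l²(#Cp)²n_l` and `κ_Q := Σ_l ω_l·k_l`): from the level data of
`hasMajorant_comm_levelSum`, per cube `□ = i` within-level-block oscillation bounds `o_{l,□}(b) ∈ [0, ω_l]` VANISHING for geometry
blocks `b ∉ S′_□`, the size letters `|a_l|·wb_l²(#Cp)²n_l·(L^{j_b}η)² ≤ k_l`, and `d(b,b) ≤ ρ`.  Print's sizes (ω_l = O(M^{−1}),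
k_l = O(a_l)) are NOT asserted. [cite: Balaban1985BackgroundPropagators, (3.88)–(3.89) p.409; (3.16) p.393] -/
theorem commData_levelSum (blk : St × Cp → g.Site) (blkJ : J → St → B) (W : J → St → ℝ)
    (T : J → St → Cp → Cp → ℝ) (a : J → ℝ) (wb : J → ℝ) (n : J → ℕ)
    (hnest : ∀ j (p q : St × Cp), blkJ j q.1 = blkJ j p.1 → blk q = blk p)
    (hW : ∀ j x, |W j x| ≤ wb j) (hT : ∀ j x i i', |T j x i i'| ≤ 1)
    (hn : ∀ j x, (univ.filter fun x' => blkJ j x' = blkJ j x).card ≤ n j)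
    (ρ : ℝ) (hρ : ∀ b : g.Site, g.dist b b ≤ ρ) (k ω₀ : J → ℝ)
    (hk : ∀ j (b : g.Site), |a j| * (wb j ^ 2 * (Fintype.card Cp : ℝ) ^ 2 * n j) * g.len b ^ 2 ≤ k j)
    (hs : ι → St → ℝ) (S' : ι → Finset g.Site) (o : ι → J → g.Site → ℝ)
    (ho0 : ∀ i j b, 0 ≤ o i j b) (hob : ∀ i j b, o i j b ≤ ω₀ j) (hoS : ∀ i j b, o i j b ≠ 0 → b ∈ S' i)
    (hosc : ∀ i j (p q : St × Cp), blkJ j q.1 = blkJ j p.1 → |hs i p.1 - hs i q.1| ≤ o i j (blk p)) :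
    (∀ i, HasMajorant (g := toB6 g R H) blk
        (mulOp (hs i ∘ Prod.fst) * levelSum blkJ W T a - levelSum blkJ W T a * mulOp (hs i ∘ Prod.fst))
        (fun b y' : g.Site => if b = y' then ∑ j, |a j| * o i j b * (wb j ^ 2 * (Fintype.card Cp : ℝ) ^ 2 * n j) else 0))
    ∧ (∀ i (b y' : g.Site),
        0 ≤ (if b = y' then ∑ j, |a j| * o i j b * (wb j ^ 2 * (Fintype.card Cp : ℝ) ^ 2 * n j) else 0))
    ∧ (∀ i (b y' : g.Site),
        (if b = y' then ∑ j, |a j| * o i j b * (wb j ^ 2 * (Fintype.card Cp : ℝ) ^ 2 * n j) else 0) ≠ 0 →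
          g.dist b y' ≤ ρ)
    ∧ (∀ i (b : g.Site), ∑ y' : g.Site,
        (if b = y' then ∑ j, |a j| * o i j b * (wb j ^ 2 * (Fintype.card Cp : ℝ) ^ 2 * n j) else 0) * g.len y' ^ 2
          ≤ if b ∈ S' i then ∑ j, ω₀ j * k j else 0)
    ∧ (∀ i (y' : g.Site), (∑ b : g.Site,
        (if b = y' then ∑ j, |a j| * o i j b * (wb j ^ 2 * (Fintype.card Cp : ℝ) ^ 2 * n j) else 0)) * g.len y' ^ 2
          ≤ if y' ∈ S' i then ∑ j, ω₀ j * k j else 0) := by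
  have hC : ∀ j, 0 ≤ wb j ^ 2 * (Fintype.card Cp : ℝ) ^ 2 * n j := fun j =>
    mul_nonneg (mul_nonneg (sq_nonneg _) (sq_nonneg _)) (Nat.cast_nonneg _)
  have hsum0 : ∀ i b, 0 ≤ ∑ j, |a j| * o i j b * (wb j ^ 2 * (Fintype.card Cp : ℝ) ^ 2 * n j) := fun i b =>
    Finset.sum_nonneg fun j _ => mul_nonneg (mul_nonneg (abs_nonneg _) (ho0 _ _ _)) (hC j)
  -- the diagonal value against (L^{j_b}η)² is ≤ 1_{S′}(b)·Σ_j ω₀_j k_j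
  have hdiag : ∀ i b, (∑ j, |a j| * o i j b * (wb j ^ 2 * (Fintype.card Cp : ℝ) ^ 2 * n j)) * g.len b ^ 2 ≤
      if b ∈ S' i then ∑ j, ω₀ j * k j else 0 := fun i b => by
    by_cases hb : b ∈ S' i
    · rw [if_pos hb, Finset.sum_mul]
      refine Finset.sum_le_sum fun j _ => ?_
      have hω : 0 ≤ ω₀ j := (ho0 i j b).trans (hob i j b)
      calc |a j| * o i j b * (wb j ^ 2 * (Fintype.card Cp : ℝ) ^ 2 * n j) * g.len b ^ 2
          = o i j b * (|a j| * (wb j ^ 2 * (Fintype.card Cp : ℝ) ^ 2 * n j) * g.len b ^ 2) := by ring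
        _ ≤ ω₀ j * k j := mul_le_mul (hob i j b) (hk j b)
            (mul_nonneg (mul_nonneg (abs_nonneg _) (hC j)) (sq_nonneg _)) hω
    · rw [if_neg hb]
      have h0 : ∀ j, o i j b = 0 := fun j => by
        by_contra hne
        exact hb (hoS i j b hne)
      simp [h0]
  refine ⟨fun i => hasMajorant_comm_levelSum blk blkJ W T a wb n hnest hW hT hn (hs i) (o i) (ho0 i) (hosc i),
    fun i b y' => ?_, fun i b y' hne => ?_, fun i b => ?_, fun i y' => ?_⟩
  · split_ifs
    · exact hsum0 i b
    · exact le_rfl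
  · by_cases h : b = y'
    · rw [← h]; exact hρ b
    · exact absurd (if_neg h) hne
  · rw [Finset.sum_eq_single b (fun y' _ hy' => by rw [if_neg (Ne.symm hy'), zero_mul])
      (fun h => absurd (mem_univ b) h), if_pos rfl]
    exact hdiag i b
  · rw [Finset.sum_eq_single y' (fun b _ hb => by rw [if_neg hb]) (fun h => absurd (mem_univ y') h), if_pos rfl]
    exact hdiag i y'

end Bundled

/-! ## §4  The k-fold comb tower: the five Q-binders for the averaging part of the tower operator -/

section Tower

variable {g : B9.Geometry} [Fintype g.Site] [DecidableEq g.Site] {R : ℝ} {H : Prop}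
  {St Bd Cp ι : Type} [Fintype St] [DecidableEq St] [Fintype Cp] [DecidableEq Cp] {src tgt : Bd → St}
  {Bs : ℕ → Type} [∀ j, DecidableEq (Bs j)] (Ks : ∀ j, Comb src tgt (Bs j))
  (Rm : Bd → Cp → Cp → ℝ)

omit [Fintype g.Site] [DecidableEq g.Site] [Fintype St] [DecidableEq St] [∀ j, DecidableEq (Bs j)] in
/-- Transport entries of the tower are bounded by one (columns orthonormal, `towerTr_orth`: the ordered products of bond matrices
along the comb paths of (3.19) are isometries). [cite: Balaban1985BackgroundPropagators, (3.19) p.393] -/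
theorem abs_towerTr_le_one (hRm : ∀ b i j, ∑ k, Rm b k i * Rm b k j = if i = j then (1 : ℝ) else 0)
    (l : ℕ) (x : St) (i i' : Cp) : |towerTr Ks Rm l x i i'| ≤ 1 :=
  B9Thm37GlueSz.abs_Rm_le_one (fun x : St => towerTr Ks Rm l x) (fun x => towerTr_orth Ks Rm hRm l x) x i i'

/-- **THE Q-DATA FOR THE AVERAGING PART Σ_{l≤k} a_lG_lᵀG_l OF THE TOWER OPERATOR** (`B9Thm37GlueTorusCovTowerPU.towerOp_def`:
Δ′ = D\*D + this level sum; its commutator with M_h is the third summand of `towerK`): `commData_levelSum` with the tower's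
blockings `towerBlk Ks l` (NESTED: `towerBlk_eq_of_le`, so a geometry blocking through which the TOP level factors — `hnestTop` —
is coarser than every level), ordered-product transports `towerTr Ks Rm l` (entries ≤ 1 for isometric bond matrices), block
counts `towerN n l` (`card_towerBlk_fibre_le` from per-comb counts `n_j`), block weights `|W_l| ≤ wb_l`; oscillation, size and
localisation letters as in §3.  OUTPUT: the five binders `hQ hKQ hlocQ hrowQ hcolQ` for
`Qf := levelSum (towerBlk) W (towerTr) a` with `κ_Q = Σ_{l≤k} ω_l·k_l`. [cite: Balaban1985BackgroundPropagators, (3.16) p.393 + (3.88)–(3.89) p.409] -/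
theorem commData_towerLevelSum (hRm : ∀ b i j, ∑ k, Rm b k i * Rm b k j = if i = j then (1 : ℝ) else 0)
    (k : ℕ) (W : Fin (k + 1) → St → ℝ) (a : Fin (k + 1) → ℝ) (wb : Fin (k + 1) → ℝ) (n : ℕ → ℕ)
    (blk : St × Cp → g.Site)
    (hnestTop : ∀ p q : St × Cp, towerBlk Ks k q.1 = towerBlk Ks k p.1 → blk q = blk p)
    (hW : ∀ l x, |W l x| ≤ wb l) (hn : ∀ j β, (univ.filter fun x => (Ks j).blk x = β).card ≤ n j)
    (ρ : ℝ) (hρ : ∀ b : g.Site, g.dist b b ≤ ρ) (kk ω₀ : Fin (k + 1) → ℝ)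
    (hk : ∀ l (b : g.Site), |a l| * (wb l ^ 2 * (Fintype.card Cp : ℝ) ^ 2 * towerN n l) * g.len b ^ 2 ≤ kk l)
    (hs : ι → St → ℝ) (S' : ι → Finset g.Site) (o : ι → Fin (k + 1) → g.Site → ℝ)
    (ho0 : ∀ i l b, 0 ≤ o i l b) (hob : ∀ i l b, o i l b ≤ ω₀ l) (hoS : ∀ i l b, o i l b ≠ 0 → b ∈ S' i)
    (hosc : ∀ i (l : Fin (k + 1)) (p q : St × Cp), towerBlk Ks l q.1 = towerBlk Ks l p.1 →
      |hs i p.1 - hs i q.1| ≤ o i l (blk p)) :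
    (∀ i, HasMajorant (g := toB6 g R H) blk
        (mulOp (hs i ∘ Prod.fst) *
            levelSum (fun l : Fin (k + 1) => towerBlk Ks (l : ℕ)) W (fun l => towerTr Ks Rm (l : ℕ)) a -
          levelSum (fun l : Fin (k + 1) => towerBlk Ks (l : ℕ)) W (fun l => towerTr Ks Rm (l : ℕ)) a *
            mulOp (hs i ∘ Prod.fst))
        (fun b y' : g.Site => if b = y' then
          ∑ l, |a l| * o i l b * (wb l ^ 2 * (Fintype.card Cp : ℝ) ^ 2 * towerN n l) else 0))
    ∧ (∀ i (b y' : g.Site),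
        0 ≤ (if b = y' then ∑ l, |a l| * o i l b * (wb l ^ 2 * (Fintype.card Cp : ℝ) ^ 2 * towerN n l) else 0))
    ∧ (∀ i (b y' : g.Site),
        (if b = y' then ∑ l, |a l| * o i l b * (wb l ^ 2 * (Fintype.card Cp : ℝ) ^ 2 * towerN n l) else 0) ≠ 0 →
          g.dist b y' ≤ ρ)
    ∧ (∀ i (b : g.Site), ∑ y' : g.Site,
        (if b = y' then ∑ l, |a l| * o i l b * (wb l ^ 2 * (Fintype.card Cp : ℝ) ^ 2 * towerN n l) else 0) *
          g.len y' ^ 2 ≤ if b ∈ S' i then ∑ l, ω₀ l * kk l else 0)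
    ∧ (∀ i (y' : g.Site), (∑ b : g.Site,
        (if b = y' then ∑ l, |a l| * o i l b * (wb l ^ 2 * (Fintype.card Cp : ℝ) ^ 2 * towerN n l) else 0)) *
          g.len y' ^ 2 ≤ if y' ∈ S' i then ∑ l, ω₀ l * kk l else 0) :=
  commData_levelSum blk (fun l : Fin (k + 1) => towerBlk Ks (l : ℕ)) W (fun l => towerTr Ks Rm (l : ℕ)) a wb
    (fun l => towerN n l)
    (fun l p q h => hnestTop p q (towerBlk_eq_of_le Ks (Nat.le_of_lt_succ l.isLt) h))
    hW (fun l x i i' => abs_towerTr_le_one Ks Rm hRm l x i i')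
    (fun l x => card_towerBlk_fibre_le Ks hn l (towerBlk Ks l x)) ρ hρ kk ω₀ hk hs S' o ho0 hob hoS hosc

end Tower

end

end Literature.MathematicalPhysics.QuantumFieldTheory.Balaban1983to89.B9Thm37GlueLevelSumComm
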